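import Summits.QuantumFields.BalabanUV.Beta.EriceFlowEnclosureB12AsPrintedHistoryUniqueModulus

/-!
# Beta / EriceFlowEnclosureB12AsPrintedHistoryUniqueLipschitz — «g₀ = g₀(ε, g)» IS 2-LIPSCHITZ IN g ITSELF, UNIFORMLY IN THE CUT-OFF: along two
# same-length runs under fading-memory history moduli the discrepancy of the COUPLINGS at every scale — in particular of the BARE couplings — is
# at most twice the discrepancy of the renormalized couplings (β-flow team, prover 1 = recursion ∕ upper ∕ bare-coupling ∕ uniqueness side, unit
# `b2b-balaban-beta-bflow-p1`, gen 34; ROW AP-I·C × ROW U; sequel of #61g `…HistoryUniqueModulus` (the same squeeze in x = 1∕g²); gen 33's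
# NEXT-TOUCH item (A) «continuity ∕ Lipschitz of g ↦ g₀(ε, g) in g itself, not only in 1∕g²»)

HONEST FRAMING (page 1 of everything the β sub-cell writes): discharging `BetaPertH` makes Bałaban's UV stability UNCONDITIONAL — a
real constructive-QFT result; it is NOT the continuum limit and NOT the Clay problem.  HONEST DEPENDENCY (cell reorg 2026-08-19,
verbatim): «continuum YM on T⁴ ⇐ BetaPertH ∧ nine spine estimates (0/9 proved); BetaPertH ⇐ (D1) ∧ (D4) ∧ CAP+tail; G-an2-4 gates
asym, D1 and NE2/3/4.»  THIS MODULE DISCHARGES NOTHING: [folklore] algebra on top of #61g's squeeze, under node U2's HYPOTHESIS SHAPES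
`T4CouplingMatching.HistLipschitz Λ γ β`, `FadingMemory C θ Λ` (NOT printed; [I] = T. Bałaban, Commun. Math. Phys. **109** (1987) [Balaban1987RG1],
p. 298 says only that β_j *"depends also on all preceding coupling constants"*) and the AF letter `BetaLowerH b` (UNPRINTED; Theorem 2 STATED
WITHOUT PROOF, p. 259).  Nothing of Bałaban's objects is asserted.

THE STEP.  #61g: 0 ≤ 1∕g_j² − 1∕g′_j² ≤ 2(1∕g_K² − 1∕g′_K²) along two pinned-order runs (g_K ≤ g′_K).  With the exact identities
g′ − g = (1∕g² − 1∕g′²)·g²g′²∕(g + g′) and the monotonicity of (x, y) ↦ x²y²∕(x + y) in each variable, AF (every coupling of a run is at most its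
renormalized coupling: g_j ≤ g_K, g′_j ≤ g′_K) turns the squeeze in x = 1∕g² into a squeeze in g: **0 ≤ g′_j − g_j ≤ 2·(g′_K − g_K)** at every scale,
uniformly in K (`runs_lipschitz_of_fadingMemory`); on the carrier `bareCoupling_lipschitz_of_fadingMemory` and the END
**`theorem2_bareCoupling_lipschitz`**: under `Theorem2Statement` + `Definitions` + (U) + AF + fading-memory moduli, for small γ, renormalized
couplings g ≤ g̃ ≤ g₁ and EVERY K the tuned bare couplings satisfy 0 ≤ g₀(ε, g̃) − g₀(ε, g) ≤ 2(g̃ − g): «g₀ = g₀(ε, g)» is a monotone 2-LIPSCHITZ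
FUNCTION OF g ON EVERY LATTICE, with ONE constant for all ε = L^{−K} (the history-reading twin of row U's #22b ∕ #28b stability).

WHAT THIS FILE PROVES (0 sorry, 0 def):
§27 `sqProd_div_sum_mono` (x²y²∕(x + y) is monotone in each variable), `sub_le_two_mul_sub` (the transfer from 1∕g² to g), `run_le_end`
    (AF: g_j ≤ g_K), **`runs_lipschitz_of_fadingMemory`**, `bareCoupling_lipschitz_of_fadingMemory`, **`theorem2_bareCoupling_lipschitz`**.
NOT CLAIMED: any modulus, sign or bound for Bałaban's β; Theorem 2; `BetaPertH`; continuum; Clay.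
-/

namespace Summit.QuantumFields.BalabanUV.Beta.EriceFlowEnclosureB12AsPrintedHistoryUniqueLipschitz

open Finset
open Literature.MathematicalPhysics.QuantumFieldTheory.Balaban1983to89
open Literature.MathematicalPhysics.QuantumFieldTheory.Balaban1983to89.B12BetaAsPrinted
open Literature.MathematicalPhysics.QuantumFieldTheory.Balaban1983to89.FlowStep (prefixOf Box mem_box box_mono RGEqH BetaLowerH
  BetaUpperH)
open Literature.MathematicalPhysics.QuantumFieldTheory.Balaban1983to89.T4CouplingMatching (HistLipschitz FadingMemory
  inv_sq_lower_of_betaLower)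
open Summit.QuantumFields.BalabanUV.Beta.EriceFlowEnclosureB12AsPrintedUpper (tunedRuns_of_theorem2Statement)
open Summit.QuantumFields.BalabanUV.Beta.EriceFlowEnclosureB12AsPrintedTunedUpper (hrg_of_betaUpperH)
open Summit.QuantumFields.BalabanUV.Beta.EriceFlowEnclosureB12AsPrintedHistoryUnique (sum_weights_le)
open Summit.QuantumFields.BalabanUV.Beta.EriceFlowEnclosureB12AsPrintedHistoryUniqueModulus (invSq_twoSided_modulus)

noncomputable section

variable {S : Setting}

/-! ## §27 From the squeeze in 1∕g² to the squeeze in g -/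

/-- `x²y²∕(x + y)` is monotone in each variable on the positive quadrant. [folklore] -/
theorem sqProd_div_sum_mono {x y u v : ℝ} (hx : 0 < x) (hy : 0 < y) (hxu : x ≤ u) (hyv : y ≤ v) :
    x ^ 2 * y ^ 2 / (x + y) ≤ u ^ 2 * v ^ 2 / (u + v) := by
  have hu : 0 < u := lt_of_lt_of_le hx hxu
  have hv : 0 < v := lt_of_lt_of_le hy hyv
  have h1 : x ^ 2 * y ^ 2 / (x + y) ≤ u ^ 2 * y ^ 2 / (u + y) := by
    rw [div_le_div_iff₀ (by positivity) (by positivity)]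
    have : x ^ 2 * (u + y) ≤ u ^ 2 * (x + y) := by
      nlinarith [mul_nonneg (mul_nonneg hu.le hx.le) (sub_nonneg.mpr hxu),
        mul_nonneg hy.le (mul_nonneg (sub_nonneg.mpr hxu) (add_nonneg hu.le hx.le))]
    nlinarith [sq_nonneg y, mul_le_mul_of_nonneg_left this (sq_nonneg y)]
  have h2 : u ^ 2 * y ^ 2 / (u + y) ≤ u ^ 2 * v ^ 2 / (u + v) := by
    rw [div_le_div_iff₀ (by positivity) (by positivity)]
    have : y ^ 2 * (u + v) ≤ v ^ 2 * (u + y) := by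
      nlinarith [mul_nonneg (mul_nonneg hv.le hy.le) (sub_nonneg.mpr hyv),
        mul_nonneg hu.le (mul_nonneg (sub_nonneg.mpr hyv) (add_nonneg hv.le hy.le))]
    nlinarith [sq_nonneg u, mul_le_mul_of_nonneg_left this (sq_nonneg u)]
  exact h1.trans h2

/-- **The transfer from x = 1∕g² to g**: for positive x ≤ u, y ≤ v with `0 ≤ 1∕x² − 1∕y² ≤ 2·(1∕u² − 1∕v²)`:  `0 ≤ y − x ≤ 2·(v − u)` —
y − x = (1∕x² − 1∕y²)·x²y²∕(x + y), v − u likewise, and `sqProd_div_sum_mono`. [folklore] -/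
theorem sub_le_two_mul_sub {x y u v : ℝ} (hx : 0 < x) (hy : 0 < y) (hxu : x ≤ u) (hyv : y ≤ v)
    (h0 : 0 ≤ 1 / x ^ 2 - 1 / y ^ 2) (h2 : 1 / x ^ 2 - 1 / y ^ 2 ≤ 2 * (1 / u ^ 2 - 1 / v ^ 2)) :
    0 ≤ y - x ∧ y - x ≤ 2 * (v - u) := by
  have hu : 0 < u := lt_of_lt_of_le hx hxu
  have hv : 0 < v := lt_of_lt_of_le hy hyv
  have e1 : y - x = (1 / x ^ 2 - 1 / y ^ 2) * (x ^ 2 * y ^ 2 / (x + y)) := by field_simp; ring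
  have e2 : v - u = (1 / u ^ 2 - 1 / v ^ 2) * (u ^ 2 * v ^ 2 / (u + v)) := by field_simp; ring
  have hf0 : 0 ≤ x ^ 2 * y ^ 2 / (x + y) := by positivity
  have hΔ : 0 ≤ 1 / u ^ 2 - 1 / v ^ 2 := by linarith
  refine ⟨by rw [e1]; exact mul_nonneg h0 hf0, ?_⟩
  rw [e1, e2]
  calc (1 / x ^ 2 - 1 / y ^ 2) * (x ^ 2 * y ^ 2 / (x + y)) ≤ 2 * (1 / u ^ 2 - 1 / v ^ 2) * (x ^ 2 * y ^ 2 / (x + y)) :=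
        mul_le_mul_of_nonneg_right h2 hf0
    _ ≤ 2 * (1 / u ^ 2 - 1 / v ^ 2) * (u ^ 2 * v ^ 2 / (u + v)) :=
        mul_le_mul_of_nonneg_left (sqProd_div_sum_mono hx hy hxu hyv) (by positivity)
    _ = 2 * ((1 / u ^ 2 - 1 / v ^ 2) * (u ^ 2 * v ^ 2 / (u + v))) := by ring

/-- **AF: every coupling of a run is at most its renormalized coupling** — with a lower letter `b ≤ β_{k+1}` (b ≥ 0) on the boxes and couplings in
]0, γ], `g_j ≤ g_K` (from 1∕g_j² ≥ 1∕g_K² + b(K − j), `inv_sq_lower_of_betaLower`). [cite: Balaban1987RG1, (0.31) p.259] -/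
theorem run_le_end {γ b : ℝ} {K : ℕ} {g : ℕ → ℝ} (hb : 0 ≤ b) (hg : RGEqH K S.β g)
    (hbox : ∀ i, i ≤ K → 0 < g i ∧ g i ≤ γ) (hlo : BetaLowerH b γ S.β) {j : ℕ} (hj : j ≤ K) : g j ≤ g K := by
  have h := inv_sq_lower_of_betaLower hg hbox hlo hj
  have hbj : 0 ≤ b * ((K - j : ℕ) : ℝ) := mul_nonneg hb (Nat.cast_nonneg _)
  have hle : 1 / (g K) ^ 2 ≤ 1 / (g j) ^ 2 := by linarith
  have hgj := hbox j hj
  have hgK := hbox K le_rfl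
  have hsq : (g j) ^ 2 ≤ (g K) ^ 2 := (one_div_le_one_div (pow_pos hgK.1 2) (pow_pos hgj.1 2)).mp hle
  exact (pow_le_pow_iff_left₀ hgj.1.le hgK.1.le two_ne_zero).mp hsq

/-- **THE COUPLINGS THEMSELVES ARE SQUEEZED, UNIFORMLY IN K.**  Two runs of (0.20) of the same length K with the same β, couplings in ]0, γ],
`HistLipschitz Λ γ S.β` with `FadingMemory C θ Λ` (0 < θ < 1), the AF letter `BetaLowerH b` (b > 0; it gives both the weight sum Σ g_i²g′_i ≤ γ³ + 2γ∕b
and g_j ≤ g_K), the smallness C(γ³ + 2γ∕b) ≤ (1 − θ)∕2, and the order g_K ≤ g′_K at the renormalized end ⟹ at every scale j ≤ K: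
`0 ≤ g′_j − g_j ≤ 2·(g′_K − g_K)`.  In particular at j = 0: the bare couplings differ by at most twice the renormalized ones.
[cite: Balaban1987RG1, Thm 2 p.259 («g₀ = g₀(ε, g)») with (0.20) p.256 and p.298] -/
theorem runs_lipschitz_of_fadingMemory {γ θ C b : ℝ} {Λ : ℕ → ℕ → ℝ} {K : ℕ} {g g' : ℕ → ℝ}
    (hθ0 : 0 < θ) (hθ1 : θ < 1) (hC : 0 ≤ C) (hγ : 0 < γ) (hb : 0 < b)
    (hg : RGEqH K S.β g) (hg' : RGEqH K S.β g')
    (hbox : ∀ i, i ≤ K → 0 < g i ∧ g i ≤ γ) (hbox' : ∀ i, i ≤ K → 0 < g' i ∧ g' i ≤ γ)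
    (hL : HistLipschitz Λ γ S.β) (hΛ : FadingMemory C θ Λ) (hlo : BetaLowerH b γ S.β)
    (hsmall : C * (γ ^ 3 + 2 * γ / b) ≤ (1 - θ) / 2) (hle : g K ≤ g' K) {j : ℕ} (hj : j ≤ K) :
    0 ≤ g' j - g j ∧ g' j - g j ≤ 2 * (g' K - g K) := by
  have hsq := invSq_twoSided_modulus hθ0 hθ1 hC hg hg' hbox hbox' hL hΛ (sum_weights_le hγ hb hg hg' hbox hbox' hlo) hsmall hle hj
  exact sub_le_two_mul_sub (hbox j hj).1 (hbox' j hj).1 (run_le_end hb.le hg hbox hlo hj) (run_le_end hb.le hg' hbox' hlo hj)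
    hsq.1 hsq.2

/-- **ON THE CARRIER: «g₀(ε, g)» IS MONOTONE AND 2-LIPSCHITZ IN g, UNIFORMLY IN K.**  With the printed `Definitions` (runs start at their bare
coupling, (0.18)), two in-interval runs (K, m, g₀), (K, m, g₀′) of (0.20) with g_K ≤ g′_K satisfy `0 ≤ g₀′ − g₀ ≤ 2·(g′_K − g_K)` under the
fading-memory moduli, the AF letter and the smallness of `runs_lipschitz_of_fadingMemory`. [cite: Balaban1987RG1, Thm 2 p.259 («g₀ = g₀(ε, g)») with (0.18)–(0.20) pp.255–256 and p.298] -/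
theorem bareCoupling_lipschitz_of_fadingMemory (hD : Definitions S) {γ θ C b : ℝ} {Λ : ℕ → ℕ → ℝ}
    (hθ0 : 0 < θ) (hθ1 : θ < 1) (hC : 0 ≤ C) (hγ : 0 < γ) (hb : 0 < b)
    (hL : HistLipschitz Λ γ S.β) (hΛ : FadingMemory C θ Λ) (hlo : BetaLowerH b γ S.β)
    (hsmall : C * (γ ^ 3 + 2 * γ / b) ≤ (1 - θ) / 2) {K m : ℕ} {g₀ g₀' : ℝ}
    (hrg : RGEqH K S.β (S.cpl ⟨K, m, g₀⟩)) (hrg' : RGEqH K S.β (S.cpl ⟨K, m, g₀'⟩))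
    (hI : Step.InInterval γ K (S.cpl ⟨K, m, g₀⟩)) (hI' : Step.InInterval γ K (S.cpl ⟨K, m, g₀'⟩))
    (hle : S.cpl ⟨K, m, g₀⟩ K ≤ S.cpl ⟨K, m, g₀'⟩ K) :
    0 ≤ g₀' - g₀ ∧ g₀' - g₀ ≤ 2 * (S.cpl ⟨K, m, g₀'⟩ K - S.cpl ⟨K, m, g₀⟩ K) := by
  have h := runs_lipschitz_of_fadingMemory hθ0 hθ1 hC hγ hb hrg hrg' hI hI' hL hΛ hlo hsmall hle (Nat.zero_le K)
  rwa [hD.d018, hD.d018] at h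

/-- **END — THEOREM 2's «g₀ = g₀(ε, g)» IS A MONOTONE 2-LIPSCHITZ FUNCTION OF g ON EVERY LATTICE, ONE CONSTANT FOR ALL ε = L^{−K}.**
`Theorem2Statement S hL` ([I] Theorem 2 AS PRINTED, a HYPOTHESIS: it supplies the tuned runs), the printed `Definitions`, the box-wide upper letter
(U) `β_{k+1} ≤ b′` on ]0, γ_u]^{k+1} (whence (0.20) inside the interval, `…TunedUpper.hrg_of_betaUpperH`), the AF letter `b ≤ β_{k+1}` (b > 0), history
moduli `HistLipschitz Λ γ_u S.β` with `FadingMemory C θ Λ` (0 < θ < 1), a box size γ₁ ≤ γ_u with b′γ₁² < 1 and C(γ₁³ + 2γ₁∕b) ≤ (1 − θ)∕2 ⟹ for every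
m there is γ₂ > 0 such that for every γ ≤ γ₂ there is g₁ > 0 such that for all renormalized couplings 0 < g ≤ g̃ ≤ g₁ and EVERY K: tuned bare
couplings exist for g and for g̃, and ANY such pair satisfies `0 ≤ g̃₀ − g₀ ≤ 2·(g̃ − g)`.  With #61e (unique), #61f (strictly increasing), #61g
(2-Lipschitz in 1∕g²): the history-reading portrait of the function g₀(ε, ·) is complete at fixed ε.  A REDUCTION over UNPRINTED letters;
nothing of [I] asserted. [cite: Balaban1987RG1, Thm 2 (0.31) p.259 with (0.20) p.256 and p.298] -/
theorem theorem2_bareCoupling_lipschitz {hL : Odd S.L ∧ 1 < S.L} (h : Theorem2Statement S hL) (hD : Definitions S)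
    {γu γ₁ b b' θ C : ℝ} {Λ : ℕ → ℕ → ℝ} (hup : BetaUpperH b' γu S.β) (hlo : BetaLowerH b γu S.β) (hb : 0 < b)
    (hL' : HistLipschitz Λ γu S.β) (hΛ : FadingMemory C θ Λ) (hθ0 : 0 < θ) (hθ1 : θ < 1) (hC : 0 ≤ C)
    (hγ₁ : 0 < γ₁) (hγ₁u : γ₁ ≤ γu) (hbu : b' * γ₁ ^ 2 < 1) (hsmall : C * (γ₁ ^ 3 + 2 * γ₁ / b) ≤ (1 - θ) / 2) (m : ℕ) :
    ∃ γ₂ : ℝ, 0 < γ₂ ∧ ∀ γ : ℝ, 0 < γ → γ ≤ γ₂ → ∃ g₁ : ℝ, 0 < g₁ ∧ ∀ g gt : ℝ, 0 < g → g ≤ gt → gt ≤ g₁ → ∀ K : ℕ,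
      (∃ g₀ : ℝ, Step.InInterval γ K (S.cpl ⟨K, m, g₀⟩) ∧ S.cpl ⟨K, m, g₀⟩ K = g) ∧
      (∃ gt₀ : ℝ, Step.InInterval γ K (S.cpl ⟨K, m, gt₀⟩) ∧ S.cpl ⟨K, m, gt₀⟩ K = gt) ∧
      ∀ g₀ gt₀ : ℝ, Step.InInterval γ K (S.cpl ⟨K, m, g₀⟩) → S.cpl ⟨K, m, g₀⟩ K = g →
        Step.InInterval γ K (S.cpl ⟨K, m, gt₀⟩) → S.cpl ⟨K, m, gt₀⟩ K = gt →
          0 ≤ gt₀ - g₀ ∧ gt₀ - g₀ ≤ 2 * (gt - g) := by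
  obtain ⟨γ₀, hγ₀, hγ⟩ := tunedRuns_of_theorem2Statement h m
  refine ⟨min γ₀ γ₁, lt_min hγ₀ hγ₁, fun γ hγpos hγle => ?_⟩
  have hγ₀le : γ ≤ γ₀ := hγle.trans (min_le_left _ _)
  have hγ₁le : γ ≤ γ₁ := hγle.trans (min_le_right _ _)
  have hγule : γ ≤ γu := hγ₁le.trans hγ₁u
  obtain ⟨g₁, hg₁, hg⟩ := hγ γ hγpos hγ₀le
  refine ⟨g₁, hg₁, fun g gt hgpos hggt hgtle K => ?_⟩
  have hgtpos : 0 < gt := lt_of_lt_of_le hgpos hggt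
  obtain ⟨β, β', -, -, hKg⟩ := hg g hgpos (hggt.trans hgtle)
  obtain ⟨βt, βt', -, -, hKt⟩ := hg gt hgtpos hgtle
  obtain ⟨g₀, hI, hend, -⟩ := hKg K
  obtain ⟨gt₀, hIt, hendt, -⟩ := hKt K
  -- the letters on the smaller box ]0, γ]
  have hup' : BetaUpperH b' γ S.β := fun k v hv => hup k v (box_mono hγule k hv)
  have hlo' : BetaLowerH b γ S.β := fun k v hv => hlo k v (box_mono hγule k hv)
  have hLγ : HistLipschitz Λ γ S.β := fun k p q hp hq => hL' k p q (box_mono hγule k hp) (box_mono hγule k hq)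
  have hγsq : γ ^ 2 ≤ γ₁ ^ 2 := pow_le_pow_left₀ hγpos.le hγ₁le 2
  have hbγ : b' * γ ^ 2 < 1 := by
    rcases le_or_gt 0 b' with hb' | hb'
    · exact lt_of_le_of_lt (mul_le_mul_of_nonneg_left hγsq hb') hbu
    · nlinarith [sq_nonneg γ]
  have hmono : γ ^ 3 + 2 * γ / b ≤ γ₁ ^ 3 + 2 * γ₁ / b :=
    add_le_add (pow_le_pow_left₀ hγpos.le hγ₁le 3) (div_le_div_of_nonneg_right (by linarith) hb.le)
  have hsmallγ : C * (γ ^ 3 + 2 * γ / b) ≤ (1 - θ) / 2 := (mul_le_mul_of_nonneg_left hmono hC).trans hsmall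
  refine ⟨⟨g₀, hI, hend⟩, ⟨gt₀, hIt, hendt⟩, fun x₀ y₀ hIx hendx hIy hendy => ?_⟩
  have hle : S.cpl ⟨K, m, x₀⟩ K ≤ S.cpl ⟨K, m, y₀⟩ K := by rw [hendx, hendy]; exact hggt
  have hres := bareCoupling_lipschitz_of_fadingMemory hD hθ0 hθ1 hC hγpos hb hLγ hΛ hlo' hsmallγ
    (hrg_of_betaUpperH hD hγpos hup' hbγ ⟨K, m, x₀⟩ hIx) (hrg_of_betaUpperH hD hγpos hup' hbγ ⟨K, m, y₀⟩ hIy) hIx hIy hle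
  rw [hendx, hendy] at hres
  exact hres

end

end Summit.QuantumFields.BalabanUV.Beta.EriceFlowEnclosureB12AsPrintedHistoryUniqueLipschitz
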